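import Literature.AnabelianGeometry.EtaleTheta.TemperedFrobenioidCor38Sub
import HarnessLib

/-!
# [EtTh] Cor. 3.8, proof row C38-L04 `PreservesOTri` / Thm. 3.4 (iii) row `PreservesLinear`: the Frobenius
# degree is RIGID on `O^▷(A)` at EVERY object, for EVERY functor between model Frobenioids

S. Mochizuki, *The étale theta function and its Frobenioid-theoretic manifestations*, Publ. RIMS **45**
(2009), Cor. 3.8, proof, PDF p. 81 l. 5–8: "it follows that `Ψ` preserves the submonoids '`O^▷(−)`'"
[cite: MochizukiEtTh2009, Cor 3.8 p.81]; S. Mochizuki, *The geometry of Frobenioids I*, Kyushu J. Math.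
**62** (2008), Thm. 5.2 (i) p. 100 (the model Frobenioid: objects `(A_D, α)`, morphisms
`(deg_Fr, Base, Div, u)`) [cite: MochizukiFrdI2008, Thm. 5.2(i) p.100].

abc-iut cell, block F, seat abc-iut-f-146 (gen 4); FACT-LIST rows F-2812 `Cor38Hyp.PreservesOTri` and F-2815
`Cor38Hyp.PreservesLinear` of `TemperedFrobenioidCor38Sub.lean` (closure side).  PROOF-ONLY file, no
definition.  WHAT IS PROVED (kernel piece of the closure-side census, junk-robust):

* `modelFrobenioid_degFr_map_eq_one` — for ANY functor `F` between two model-Frobenioid categories (any base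
  categories, any divisor / rational-function monoids, no Frobenioid axiom, no slimness, no FSMFF-ness, no
  non-dilation) and ANY object `X = (A_D, α)`, every base-identity LINEAR endomorphism `T = (1, id, z, u)`
  of `X` is carried to a morphism of Frobenius degree `1`.  Mechanism ("perfect powers"): with the
  Frobenius morphism `F_d = (d, id, 0, 0) : (A_D, α) → (A_D, d·α)` and the copy `T_d = (1, id, z, u)` of `T`
  at `(A_D, d·α)` one has `F_d ∘ T = T_d^{∘ d} ∘ F_d`; Frobenius degrees are multiplicative into `ℕ_{≥1}`, so
  `deg(F T) = deg(F T_d)^d` is a perfect `d`-th power for EVERY `d ≥ 1`, whence `deg(F T) = 1`.  This removes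
  the hypothesis "`A` admits a base-identity endomorphism of degree `≠ 1`" (Frobenius-trivial `A`, or
  `α = 0`) of abc-iut-f-133's `TemperedFrobenioidCor38SubOTriDegree.lean`: effective objects, which carry no
  such endomorphism, are covered too.
* Consequences for every record `h : Cor38Hyp C₁ C₂` (indeed for every functor `C₁ → C₂` of tempered
  Frobenioids): `Ψ`, `Ψ⁻¹` carry `O^▷(A)` into LINEAR endomorphisms at every `A`
  (`Cor38Hyp.isLinear_map_of_mem_endSubmonoid_all`, `…inverse…`); hence `PreservesOTri` is EQUIVALENT to its
  base-identity conjunct (`Cor38Hyp.preservesOTri_iff_isBaseIdentity`), and `PreservesLinear` holds on all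
  base-identity endomorphisms (`Cor38Hyp.preservesLinear_on_endSubmonoid`).  The degree can therefore move
  under an equivalence only on morphisms whose `Base` component is not an identity (the room used by the
  degree ↔ base-index swap certificates of the cell); nothing here decides a universal closure.
HONEST FRAMING: refereed pre-IUT material; nothing here bears on [IUTchIII] Cor. 3.12; typed ≠ proved.
-/

namespace Literature.AnabelianGeometry.EtaleTheta

open CategoryTheory Opposite Literature.AlgebraicGeometry.Frobenioids

universe u₀ v₀ u v w u₁ v₁ w₁ u₂ v₂ w₂

/-! ### Perfect powers in `ℕ_{≥1}` -/

/-- A positive integer which is a perfect `d`-th power for every `d ≥ 1` equals `1` (take `d = n`: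
`m ^ n ≥ 2 ^ n > n` unless `m = 1`). [folklore] -/
private theorem pnat_eq_one_of_forall_exists_pow_eq (n : ℕ+) (h : ∀ d : ℕ+, ∃ m : ℕ+, n = m ^ (d : ℕ)) :
    n = 1 := by
  obtain ⟨m, hm⟩ := h n
  have hnat : (n : ℕ) = (m : ℕ) ^ (n : ℕ) := by exact_mod_cast congrArg PNat.val hm
  by_cases hm1 : (m : ℕ) = 1
  · rw [hm1, one_pow] at hnat
    exact PNat.coe_inj.mp (by simpa using hnat)
  · exfalso
    have hm2 : 2 ≤ (m : ℕ) := by have := m.pos; omega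
    have h2 : 2 ^ (n : ℕ) ≤ (m : ℕ) ^ (n : ℕ) := Nat.pow_le_pow_left hm2 _
    have h3 : (n : ℕ) < 2 ^ (n : ℕ) := Nat.lt_two_pow_self
    omega

/-! ### Degree rigidity of base-identity linear endomorphisms under an arbitrary functor of model Frobenioids -/

section ModelLevel

variable {D₁ : Type u₁} [Category.{v₁} D₁] {Φ₁ B₁ : D₁ᵒᵖ ⥤ CommMonCat.{w₁}} {DivB₁ : B₁ ⟶ monoidGp Φ₁}
  {D₂ : Type u₂} [Category.{v₂} D₂] {Φ₂ B₂ : D₂ᵒᵖ ⥤ CommMonCat.{w₂}} {DivB₂ : B₂ ⟶ monoidGp Φ₂}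

/-- **Degree rigidity on `O^▷`, model-Frobenioid level.**  For ANY functor `F` between model-Frobenioid
categories ([FrdI] Thm. 5.2 (i)) and any endomorphism `T = (1, id, z, u)` of an object `X = (A_D, α)` with
`Base(T) = id` and `deg_Fr(T) = 1`, the image `F T` has Frobenius degree `1`: from
`F_d ∘ T = T_d^{∘ d} ∘ F_d` with `F_d = (d, id, 0, 0) : (A_D, α) → (A_D, d·α)`, `T_d = (1, id, z, u)`, the degree
`deg(F T) = deg(F T_d)^d` is a perfect `d`-th power for every `d`. [cite: MochizukiFrdI2008, Thm. 5.2(i) p.100] -/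
theorem modelFrobenioid_degFr_map_eq_one
    (F : ModelFrobenioid Φ₁ B₁ DivB₁ ⥤ ModelFrobenioid Φ₂ B₂ DivB₂) {X : ModelFrobenioid Φ₁ B₁ DivB₁}
    (T : X ⟶ X) (hb : ModelFrobenioid.baseMap T = 𝟙 X.base) (hd : ModelFrobenioid.degFr T = 1) :
    ModelFrobenioid.degFr (F.map T) = 1 := by
  -- the relation of `T`: `Div(T) = Div_B(u_T)` in `Φ(A)^gp`
  have hrel : Algebra.GrothendieckGroup.of (ModelFrobenioid.div T) =
      divB Φ₁ B₁ DivB₁ (op X.base) (ModelFrobenioid.unit T) := by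
    have h := ModelFrobenioid.rel T
    rw [hd, PNat.one_coe, pow_one, hb, pullGp_id] at h
    exact mul_left_cancel h
  apply pnat_eq_one_of_forall_exists_pow_eq
  intro d
  -- the Frobenius target `(A_D, d·α)`, the Frobenius morphism `F_d`, and the copies `S k = (1, id, k·z, k·u)`
  let Xd : ModelFrobenioid Φ₁ B₁ DivB₁ := ⟨X.base, X.cls ^ (d : ℕ)⟩
  let Fd : X ⟶ Xd :=
    { degFr := d
      base := 𝟙 X.base
      div := 1
      unit := 1
      rel := by
        change X.cls ^ (d : ℕ) * Algebra.GrothendieckGroup.of 1 =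
          pullGp Φ₁ (𝟙 X.base) (X.cls ^ (d : ℕ)) * divB Φ₁ B₁ DivB₁ (op X.base) 1
        rw [map_one, mul_one, map_one, mul_one, pullGp_id] }
  let S : ℕ → (Xd ⟶ Xd) := fun k =>
    { degFr := 1
      base := 𝟙 X.base
      div := ModelFrobenioid.div T ^ k
      unit := ModelFrobenioid.unit T ^ k
      rel := by
        change (X.cls ^ (d : ℕ)) ^ ((1 : ℕ+) : ℕ) * Algebra.GrothendieckGroup.of (ModelFrobenioid.div T ^ k) =
          pullGp Φ₁ (𝟙 X.base) (X.cls ^ (d : ℕ)) *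
            divB Φ₁ B₁ DivB₁ (op X.base) (ModelFrobenioid.unit T ^ k)
        rw [PNat.one_coe, pow_one, map_pow, pullGp_id, hrel, map_pow] }
  have hS0 : S 0 = 𝟙 Xd := ModelFrobenioid.hom_ext rfl rfl (pow_zero _) (pow_zero _)
  have hSsucc : ∀ k, S (k + 1) = S k ≫ S 1 := by
    intro k
    apply ModelFrobenioid.hom_ext
    · exact (mul_one _).symm
    · exact (Category.comp_id _).symm
    · change ModelFrobenioid.div T ^ (k + 1) =
        (Φ₁.map (𝟙 X.base).op).hom (ModelFrobenioid.div T ^ 1) * (ModelFrobenioid.div T ^ k) ^ ((1 : ℕ+) : ℕ)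
      rw [op_id, Φ₁.map_id, CommMonCat.hom_id, MonoidHom.id_apply, PNat.one_coe, pow_one, pow_one, pow_succ']
    · change ModelFrobenioid.unit T ^ (k + 1) =
        (B₁.map (𝟙 X.base).op).hom (ModelFrobenioid.unit T ^ 1) * (ModelFrobenioid.unit T ^ k) ^ ((1 : ℕ+) : ℕ)
      rw [op_id, B₁.map_id, CommMonCat.hom_id, MonoidHom.id_apply, PNat.one_coe, pow_one, pow_one, pow_succ']
  -- `T ≫ F_d = F_d ≫ S d`
  have hTF : T ≫ Fd = Fd ≫ S d := by
    apply ModelFrobenioid.hom_ext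
    · change d * ModelFrobenioid.degFr T = 1 * d
      rw [hd, mul_one, one_mul]
    · change ModelFrobenioid.baseMap T ≫ 𝟙 X.base = 𝟙 X.base ≫ 𝟙 X.base
      rw [hb]
    · change (Φ₁.map (ModelFrobenioid.baseMap T).op).hom 1 * ModelFrobenioid.div T ^ (d : ℕ) =
        (Φ₁.map (𝟙 X.base).op).hom (ModelFrobenioid.div T ^ (d : ℕ)) * 1 ^ ((1 : ℕ+) : ℕ)
      rw [map_one, one_mul, one_pow, mul_one, op_id, Φ₁.map_id, CommMonCat.hom_id, MonoidHom.id_apply]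
    · change (B₁.map (ModelFrobenioid.baseMap T).op).hom 1 * ModelFrobenioid.unit T ^ (d : ℕ) =
        (B₁.map (𝟙 X.base).op).hom (ModelFrobenioid.unit T ^ (d : ℕ)) * 1 ^ ((1 : ℕ+) : ℕ)
      rw [map_one, one_mul, one_pow, mul_one, op_id, B₁.map_id, CommMonCat.hom_id, MonoidHom.id_apply]
  -- degrees of the images of the copies: `deg(F (S k)) = deg(F (S 1))^k`
  have hdegS : ∀ k, ModelFrobenioid.degFr (F.map (S k)) = ModelFrobenioid.degFr (F.map (S 1)) ^ k := by
    intro k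
    induction k with
    | zero => rw [hS0, F.map_id, ModelFrobenioid.degFr_id, pow_zero]
    | succ k ih => rw [hSsucc, F.map_comp, ModelFrobenioid.degFr_comp, ih, pow_succ, mul_comm]
  refine ⟨ModelFrobenioid.degFr (F.map (S 1)), ?_⟩
  have h1 : ModelFrobenioid.degFr (F.map (T ≫ Fd)) = ModelFrobenioid.degFr (F.map (Fd ≫ S d)) := by
    rw [hTF]
  rw [F.map_comp, F.map_comp, ModelFrobenioid.degFr_comp, ModelFrobenioid.degFr_comp, hdegS, mul_comm] at h1
  -- `h1 : deg(F T) * deg(F F_d) = deg(F (S 1))^d * deg(F F_d)`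
  exact mul_right_cancel h1

end ModelLevel

/-! ### The rows of [EtTh] Cor. 3.8 (`TemperedFrobenioidCor38Sub.lean`): C38-L04 `PreservesOTri` and the
[FrdI] Thm. 3.4 (iii) row `PreservesLinear`, on `O^▷(−)`, for every `h : Cor38Hyp C₁ C₂` -/

section Rows

variable {D₀ : Type u₀} [Category.{v₀} D₀] {V : FrdIMonoidStub.{w}} {T : RealifiedDivisorMonoids (D₀ := D₀) V}
  {D : Type u} [Category.{v} D] {VD : FrdICatStub.{u, v, w} D}
  {D₀' : Type u₀} [Category.{v₀} D₀'] {T' : RealifiedDivisorMonoids (D₀ := D₀') V}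
  {D' : Type u} [Category.{v} D'] {VD' : FrdICatStub.{u, v, w} D'}
  {C₁ : TemperedFrobenioid T D VD} {C₂ : TemperedFrobenioid T' D' VD'}

/-- **Degree rigidity of `O^▷(A)` at EVERY object, for every functor of tempered Frobenioids**: any
functor `F : C₁ → C₂` (the categories of [EtTh] Def. 3.6 (ii) are model Frobenioids, [FrdI] Thm. 5.2 (i))
carries every `α ∈ O^▷(A)` ([FrdI] Def. 1.2 (ii): base-identity linear endomorphisms) to a LINEAR endomorphism
of `F A` — no hypothesis on `A`, `F`, `C₁`, `C₂`. [cite: MochizukiEtTh2009, Cor 3.8 p.81] -/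
theorem TemperedFrobenioid.isLinear_map_of_mem_endSubmonoid_all (F : C₁.category ⥤ C₂.category)
    {A : C₁.category} {α : End A} (hα : α ∈ C₁.opsData.endSubmonoid A) :
    C₂.opsData.IsLinear (F.map α) :=
  modelFrobenioid_degFr_map_eq_one F α hα.1 hα.2

namespace Cor38Hyp

variable (h : Cor38Hyp C₁ C₂)

/-- **C38-L04, degree half, for EVERY record `h` and EVERY object**: `Ψ` carries `O^▷(A)` into the linear
endomorphisms of `Ψ A`. [cite: MochizukiEtTh2009, Cor 3.8 p.81] -/
theorem isLinear_map_of_mem_endSubmonoid_all {A : C₁.category} {α : End A}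
    (hα : α ∈ C₁.opsData.endSubmonoid A) : C₂.opsData.IsLinear (h.Ψ.functor.map α) :=
  TemperedFrobenioid.isLinear_map_of_mem_endSubmonoid_all h.Ψ.functor hα

/-- The same for `Ψ⁻¹`. [cite: MochizukiEtTh2009, Cor 3.8 p.81] -/
theorem isLinear_inverse_map_of_mem_endSubmonoid_all {A : C₂.category} {α : End A}
    (hα : α ∈ C₂.opsData.endSubmonoid A) : C₁.opsData.IsLinear (h.Ψ.inverse.map α) :=
  TemperedFrobenioid.isLinear_map_of_mem_endSubmonoid_all h.Ψ.inverse hα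

/-- **`PreservesLinear` ([FrdI] Thm. 3.4 (iii) row, F-2815) holds on `O^▷(−)` for EVERY `h`**: `Ψ` and `Ψ⁻¹`
carry base-identity linear endomorphisms to linear endomorphisms (the bare closure of `PreservesLinear` can
fail only at morphisms whose `Base` component is not an identity). [cite: MochizukiEtTh2009, Cor 3.8 p.81] -/
theorem preservesLinear_on_endSubmonoid :
    (∀ ⦃A : C₁.category⦄ (α : End A), C₁.opsData.IsBaseIdentity α → C₁.opsData.IsLinear α →
        C₂.opsData.IsLinear (h.Ψ.functor.map α)) ∧
      ∀ ⦃A : C₂.category⦄ (α : End A), C₂.opsData.IsBaseIdentity α → C₂.opsData.IsLinear α →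
        C₁.opsData.IsLinear (h.Ψ.inverse.map α) :=
  ⟨fun _ _ hb hl => h.isLinear_map_of_mem_endSubmonoid_all ⟨hb, hl⟩,
    fun _ _ hb hl => h.isLinear_inverse_map_of_mem_endSubmonoid_all ⟨hb, hl⟩⟩

/-- **Reduction of C38-L04 `PreservesOTri` (F-2812) to its base-identity conjunct, for EVERY `h`**: `Ψ`
preserves the submonoids `O^▷(−)` (both directions) if and only if `Ψ` and `Ψ⁻¹` carry base-identity linear
endomorphisms to BASE-IDENTITY endomorphisms — the Frobenius-degree conjunct is automatic at every object.
[cite: MochizukiEtTh2009, Cor 3.8 p.81] -/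
theorem preservesOTri_iff_isBaseIdentity :
    h.PreservesOTri ↔
      (∀ (A : C₁.category) (α : End A), α ∈ C₁.opsData.endSubmonoid A →
          C₂.opsData.IsBaseIdentity (h.Ψ.functor.map α)) ∧
        ∀ (A : C₂.category) (α : End A), α ∈ C₂.opsData.endSubmonoid A →
          C₁.opsData.IsBaseIdentity (h.Ψ.inverse.map α) := by
  constructor
  · rintro ⟨h₁, h₂⟩
    exact ⟨fun A α hα => (h₁ A α hα).1, fun A α hα => (h₂ A α hα).1⟩
  · rintro ⟨h₁, h₂⟩
    exact ⟨fun A α hα => ⟨h₁ A α hα, h.isLinear_map_of_mem_endSubmonoid_all hα⟩,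
      fun A α hα => ⟨h₂ A α hα, h.isLinear_inverse_map_of_mem_endSubmonoid_all hα⟩⟩

end Cor38Hyp

end Rows

end Literature.AnabelianGeometry.EtaleTheta
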